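import Literature.MathematicalPhysics.QuantumFieldTheory.Balaban1983to89.B9RWSumsReadsRel

/-!
# `Balaban1983to89.B9RWSumsReadsNbr` — the (3.43)–(3.46) CO-READING SCHEMAS OF THE RANDOM-WALK SUMS WITH THE OBSERVATION SITED ON
# THE METRIC NEIGHBOURHOOD OF y (`L2ReadsNbr`, `H1ReadsNbr`, `InputReadsNbr`), and their three engines

T. Bałaban, *Propagators for lattice gauge theories in a background field*, Commun. Math. Phys. **99** (1985) 389–434
[`Balaban1985BackgroundPropagators`, "B9"], Thm 3.1 ∕ 3.3 (3.42)–(3.47) pp. 397–399: the Hölder members (3.43), (3.45) are stated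
*"for … ζ ∈ C₀^∞(Δ̃(y)), y ∈ Λ_j, supp λ ⊂ Δ(y′)"*, the L² members (3.46) *"for supp h ⊂ Δ(y), y ∈ Λ_j, supp λ ⊂ Δ(y′)"*;
T. Bałaban, *Propagators and renormalization transformations for lattice gauge theories. II*, Commun. Math. Phys. **96** (1984)
223–250 [`Balaban1984PropagatorsII`], (2.51)–(2.52) p. 232 (*"λ = Σ_{y′} Δ(y′)λ"*, the majorant piece by piece).

statement-level skeleton of published theorems with citation tags; proofs where landed; nothing here is a claim about the
Yang–Mills mass gap

WHY THIS FILE (owner's second repair of the rows-18∕19 reading layer, located 2026-08-27 g8).  The co-reading schemas of record —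
`B9RWSums346Schur.L2Reads` ∕ `B9RWSums343Holder.H1Reads` ∕ `B9RWSums344Input.InputReads` and their `Rel` re-typings
`B9RWSumsReadsRel.L2ReadsRel` ∕ `H1ReadsRel` ∕ `InputReadsRel` — OBSERVE the bounded quantity on the class of the site y only (the class sum of
the fibre-L² sizes; the probes anchored IN the class of y).  At the record geometry `geo9Y x = geo9K x.toKIdx` the cut-off predicates
`cutIn = cutInT` are N03's Δ̃-reading (*"every fine bond where the cut-off is non-zero lies in a block within torus distance ≤ 1 of the
carrier block of y"*, `B6KLevelCensusIndexV1.kGeo`), so a cut-off supported in a NEIGHBOURING block makes those observations blind and the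
`obs` fields undischargeable by any faithful model there; and the κ-fold diagonal evaluation of n06-d's device (`B9CoReadingCoords.evBK`)
has fibre-L² size `√((d+1)·|κ|)·‖λ·1_{fibre}‖₂`, so the landed `l2bound` (no constant) fails as pinned.  This file re-types the three
schemas ONCE MORE, changing exactly those fields: the support side stays RELATIVE TO THE BLOCK EQUIVALENCE `Rel` (p494292), `l2bound`
acquires a constant `Cev`, and every observation ranges over the METRIC NEIGHBOURHOOD `nbr g r y = {y″ : d(y″, y) ≤ r}` of radius r
(r = 1 is Δ̃(y); the faces take r = 2 so that a two-point probe may be anchored at either end):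

* §1 `nbr` and its bookkeeping; two cores with a FREE observation point: ★ `abs_le_of_hasMajorantHom_supp` (|(A f)(x)| ≦ m·K′(site x, y′)·N
  at EVERY model point x — n06-l's class argument on the support side only) and ★ `bl2_le_of_blockBd_supp` (every fibre-L² size of T f
  is ≦ m·K′(y″, y′)·N); the comparison lemmas on a neighbourhood (`pref6_le_of_len_le`, `rpow_one_sub_le_of_len_le`,
  `rpow_neg_le_of_len_le`, `exp_shift_of_dist_le`).
* §2 the schemas ★ `L2ReadsNbr`, ★ `H1ReadsNbr`, ★ `InputReadsNbr` (hypothesis schemas of definitional shape; nothing asserted).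
* §3 the engines, conclusions LITERALLY the member lines AS TYPED: ★ `l2line_of_blockBd_nbr` (constant mN·m·Cev·CL²·e^{rδ′}·B′),
  ★ `line343_of_hasMajorantHom_nbr` (constant m·CL·e^{rδ₀}·B(β)), ★ `lines3445_of_hasMaj_nbr` (constants e^{rδ₀}·B′(ε), CL·e^{rδ₀}·B′(ε,β)),
  under the geometric binders: neighbourhood count `(nbr g r y).card ≤ mN`, level comparability `d(a,a′) ≤ r ⇒ Lʲ⁽ᵃ⁾η ≤ CL·Lʲ⁽ᵃ′⁾η`
  (1 ≦ CL), the triangle inequality and symmetry of d, 0 ≦ δ, 0 ≦ r — at `geo9Y` all supplied by name in the sequel (`geo9Y_dist_triangle`,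
  `geo9Y_dist_symm`, `levelGap_geo9Y_one`).

HONEST SCOPE.  Hypothesis schemas and kernel bookkeeping; nothing of [B9] or [4] is asserted; whether a given instance discharges the
schemas is the instance seat's theorem.  The member∕model SHAPES of the three second-order L² lines (n = 3, 4, 5) and the two-direction
members (3.44)∕(3.45) are NOT touched here (located separately: the typed members of `Node00.kernelFamilyB` and the leaves' model operators
must first be aligned).  NOT a node discharge; count-neutral; one finite 𝕋^{d+1} programme at fixed ε — nothing continuum, nothing about
the mass gap.  Cell `pub-ymgap` (HUMAN RULING D-0062), Track A node N06 [B9], N06-ASSIGNMENT v1 bundle F6 (rows 18–19), seat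
`pub-ymgap-dag-n06-k` (gen 8), 2026-08-27.
-/

noncomputable section

namespace Literature.MathematicalPhysics.QuantumFieldTheory.Balaban1983to89.B9RWSumsReadsNbr

open Literature.MathematicalPhysics.QuantumFieldTheory.Balaban1983to89
open Finset B6RandomWalk B6RandomWalkHom B9Thm34Ext B9RWSums343to347Whole B9RWSums346Schur B9RWSums343Holder
open B9RWSums344Input B9Thm37GlueCor36 B9SectDL2Decay B11SectG B9Thm37AllNorms B9Thm37AllNormsInstances B9RWSumsReadsRel

/-! ## §1 The metric neighbourhood of a site; two cores with a free observation point; comparison on a neighbourhood -/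

section Nbr

variable (g : B9.Geometry) [Fintype g.Site]

open Classical in
/-- **the metric neighbourhood of radius r of a site**: `nbr g r y = {y″ : d(y″, y) ≤ r}` as a `Finset` (r = 1: the blocks meeting
Δ̃(y), p. 397 *"Δ̃(y)"*). [cite: Balaban1985BackgroundPropagators, p.397 (Δ̃(y)), (3.43)–(3.46) p.398, dictionary] -/
def nbr (r : ℝ) (y : g.Site) : Finset g.Site := Finset.univ.filter (fun y'' => g.dist y'' y ≤ r)

variable {g}

/-- membership in the neighbourhood. [cite: Balaban1985BackgroundPropagators, p.397 (Δ̃(y)), bookkeeping] -/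
theorem mem_nbr {r : ℝ} {y y'' : g.Site} : y'' ∈ nbr g r y ↔ g.dist y'' y ≤ r := by
  classical
  unfold nbr
  rw [Finset.mem_filter]
  exact ⟨fun h => h.2, fun h => ⟨Finset.mem_univ _, h⟩⟩

/-- a site at distance 0 from itself lies in each of its neighbourhoods of radius r ≧ 0. [cite: Balaban1985BackgroundPropagators, p.397, bookkeeping] -/
theorem self_mem_nbr {r : ℝ} (hr : 0 ≤ r) {y : g.Site} (h0 : g.dist y y = 0) : y ∈ nbr g r y :=
  mem_nbr.2 (by rw [h0]; exact hr)

/-- a sum of non-negative terms over the neighbourhood dominates each of its terms (how an instance passes from one block of the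
neighbourhood to the `obs` premise). [cite: Balaban1985BackgroundPropagators, p.397 (Δ̃(y)), bookkeeping] -/
theorem le_sum_nbr {r : ℝ} {y y'' : g.Site} (hy : y'' ∈ nbr g r y) {F : g.Site → ℝ} (hF : ∀ z, 0 ≤ F z) :
    F y'' ≤ ∑ z ∈ nbr g r y, F z :=
  Finset.single_le_sum (fun z _ => hF z) hy

end Nbr

section Cores

variable {g : B9.Geometry} [Fintype g.Site] [DecidableEq g.Site] {R : ℝ} {H : Prop}
variable {u v : Type}

/-- ★ **[4]-(2.51) MAJORANT READ AT A FREE MODEL POINT, SUPPORT SIDE RELATIVE TO `Rel`.**  If A has the two-lattice majorant K′ ≧ 0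
between the fibres of `bv`, `bu`, K′ is saturated for `Rel` in its SECOND argument, every class has at most m members, and f lives on the
fibres of the class of y′ with |f| ≦ N, then |(A f)(x)| ≦ m·K′(site of x, y′)·N at EVERY model point x (*"λ = Σ_{y″} Δ(y″)λ"*, the pieces
outside the class vanish, the majorant piece by piece, saturation, the class count).
[cite: Balaban1985BackgroundPropagators, (3.42) p.397; Balaban1984PropagatorsII, (2.51)–(2.52) p.232] -/
theorem abs_le_of_hasMajorantHom_supp {Rel : g.Site → g.Site → Prop} [DecidableRel Rel] {bu : u → g.Site} {bv : v → g.Site}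
    {A : (v → ℝ) →ₗ[ℝ] (u → ℝ)} {K' : g.Site → g.Site → ℝ} (hK' : ∀ a b, 0 ≤ K' a b)
    (hsat₂ : ∀ a b b', Rel b b' → K' a b = K' a b')
    {m : ℕ} (hmult : ∀ y' : g.Site, (Finset.univ.filter (fun y'' => Rel y'' y')).card ≤ m)
    (hA : HasMajorantHom (g := toB6 g R H) bv bu A K') {f : v → ℝ} {N : ℝ} (hN : 0 ≤ N) (hbd : ∀ x', |f x'| ≤ N)
    {y' : g.Site} (hoff : ∀ x', ¬ Rel (bv x') y' → f x' = 0) (x : u) :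
    |A f x| ≤ m * K' (bu x) y' * N := by
  -- adapted from n06-l's `B9CoRealizesRel.le_of_hasMajorantHom_of_coRealizesRel` (support side only)
  classical
  have hKN : 0 ≤ K' (bu x) y' * N := mul_nonneg (hK' _ y') hN
  have hdec : f = ∑ y'' : (toB6 g R H).Site, blockPiece (g := toB6 g R H) bv y'' f :=
    (sum_blockPiece (g := toB6 g R H) bv f).symm
  have hzero : ∀ y'' : g.Site, ¬ Rel y'' y' → blockPiece (g := toB6 g R H) bv y'' f = 0 := by
    intro y'' hy''
    funext x'
    by_cases hx' : bv x' = y''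
    · simp only [blockPiece, hx', if_true, Pi.zero_apply]
      exact hoff x' (by rw [hx']; exact hy'')
    · simp only [blockPiece, Pi.zero_apply]
      split_ifs with h
      · exact absurd h hx'
      · rfl
  have hpiece : ∀ y'' : g.Site, BlockSupp (g := toB6 g R H) bv (blockPiece (g := toB6 g R H) bv y'' f) y'' N := fun y'' =>
    { nonneg := hN
      bound := fun z hz => by
        simp only [blockPiece, hz, if_true]
        exact hbd z
      off := fun z hz => by simp only [blockPiece, hz, if_false] }
  have hterm : ∀ y'' : g.Site, |A (blockPiece (g := toB6 g R H) bv y'' f) x| ≤ if Rel y'' y' then K' (bu x) y' * N else 0 := by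
    intro y''
    by_cases hr : Rel y'' y'
    · rw [if_pos hr]
      have h1 := hA y'' _ N (hpiece y'') x
      rw [hsat₂ _ _ _ hr] at h1
      exact h1
    · rw [if_neg hr, hzero y'' hr, map_zero, Pi.zero_apply, abs_zero]
  have hAf : A f = ∑ y'' : (toB6 g R H).Site, A (blockPiece (g := toB6 g R H) bv y'' f) := by
    conv_lhs => rw [hdec]
    rw [map_sum]
  calc |A f x| = |∑ y'' : (toB6 g R H).Site, A (blockPiece (g := toB6 g R H) bv y'' f) x| := by rw [hAf, Finset.sum_apply]
    _ ≤ ∑ y'' : (toB6 g R H).Site, |A (blockPiece (g := toB6 g R H) bv y'' f) x| := Finset.abs_sum_le_sum_abs _ _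
    _ ≤ ∑ y'' : g.Site, (if Rel y'' y' then K' (bu x) y' * N else 0) := Finset.sum_le_sum fun y'' _ => hterm y''
    _ = ((Finset.univ.filter (fun y'' => Rel y'' y')).card : ℝ) * (K' (bu x) y' * N) := by
        rw [Finset.sum_ite, Finset.sum_const_zero, add_zero, Finset.sum_const, nsmul_eq_mul]
    _ ≤ (m : ℝ) * (K' (bu x) y' * N) := mul_le_mul_of_nonneg_right (by exact_mod_cast hmult y') hKN
    _ = m * K' (bu x) y' * N := by ring

omit [DecidableEq g.Site] in
/-- Minkowski for the block-L² size over a finite sum: ‖1_{Δ(y)} Σ_i f_i‖₂ ≦ Σ_i ‖1_{Δ(y)} f_i‖₂. [folklore] -/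
private theorem bl2_finset_sum_le' {X ι : Type} [Fintype X] (blk : X → (toB6 g R H).Site) (y : g.Site) (s : Finset ι)
    (F : ι → X → ℝ) :
    bl2 (g := toB6 g R H) blk y (∑ i ∈ s, F i) ≤ ∑ i ∈ s, bl2 (g := toB6 g R H) blk y (F i) := by
  classical
  refine Finset.induction_on s ?_ ?_
  · simp
  · intro a s ha ih
    rw [Finset.sum_insert ha, Finset.sum_insert ha]
    exact (bl2_add_le (g := toB6 g R H) blk y _ _).trans (by linarith)

/-- ★ **[4]-(2.51) MAJORANT READ ON A FREE TARGET FIBRE, L² FORM.**  If T has the block bound K′ ≧ 0 (`BlockBd`) between the fibres of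
`bv`, `bu`, K′ is saturated for `Rel` in its second argument, every class has at most m members, and f lives on the fibres of the class of
y′ with every fibre-L² size there ≦ N, then EVERY fibre-L² size of T f is ≦ m·K′(y″, y′)·N (the pieces of f by [4] (2.52), Minkowski on
the target fibre, the block bound piece by piece, saturation, the class count).
[cite: Balaban1985BackgroundPropagators, (3.46) p.398; Balaban1984PropagatorsII, (2.51)–(2.52) p.232] -/
theorem bl2_le_of_blockBd_supp [Fintype u] [Fintype v] {Rel : g.Site → g.Site → Prop} [DecidableRel Rel]
    {bu : u → g.Site} {bv : v → g.Site} {T : (v → ℝ) →ₗ[ℝ] (u → ℝ)} {K' : g.Site → g.Site → ℝ} (hK' : ∀ a b, 0 ≤ K' a b)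
    (hsat₂ : ∀ a b b', Rel b b' → K' a b = K' a b')
    {m : ℕ} (hmult : ∀ y' : g.Site, (Finset.univ.filter (fun y'' => Rel y'' y')).card ≤ m)
    (hT : BlockBd (g := toB6 g R H) bv bu T K') {f : v → ℝ} {N : ℝ} (hN : 0 ≤ N) {y' : g.Site}
    (hl2 : ∀ y'', Rel y'' y' → bl2 (g := toB6 g R H) bv y'' f ≤ N) (hoff : ∀ x', ¬ Rel (bv x') y' → f x' = 0) (y'' : g.Site) :
    bl2 (g := toB6 g R H) bu y'' (T f) ≤ m * K' y'' y' * N := by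
  classical
  have hKN : 0 ≤ K' y'' y' * N := mul_nonneg (hK' y'' y') hN
  have hdec : f = ∑ z : (toB6 g R H).Site, blockPiece (g := toB6 g R H) bv z f :=
    (sum_blockPiece (g := toB6 g R H) bv f).symm
  have hzero : ∀ z : g.Site, ¬ Rel z y' → blockPiece (g := toB6 g R H) bv z f = 0 := by
    intro z hz
    funext x'
    by_cases hx' : bv x' = z
    · simp only [blockPiece, hx', if_true, Pi.zero_apply]
      exact hoff x' (by rw [hx']; exact hz)
    · simp only [blockPiece, Pi.zero_apply]
      split_ifs with h
      · exact absurd h hx'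
      · rfl
  have hTf : T f = ∑ z : (toB6 g R H).Site, T (blockPiece (g := toB6 g R H) bv z f) := by
    conv_lhs => rw [hdec]
    rw [map_sum]
  have hterm : ∀ z : g.Site,
      bl2 (g := toB6 g R H) bu y'' (T (blockPiece (g := toB6 g R H) bv z f)) ≤ if Rel z y' then K' y'' y' * N else 0 := by
    intro z
    by_cases hr : Rel z y'
    · rw [if_pos hr]
      have hb := hT z (blockPiece (g := toB6 g R H) bv z f)
        (fun x hx => by simp only [blockPiece, hx, if_false]) y''
      rw [bl2_blockPiece_self, hsat₂ _ _ _ hr] at hb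
      exact hb.trans (mul_le_mul_of_nonneg_left (hl2 z hr) (hK' y'' y'))
    · rw [if_neg hr, hzero z hr, map_zero, bl2_zero]
  calc bl2 (g := toB6 g R H) bu y'' (T f)
      = bl2 (g := toB6 g R H) bu y'' (∑ z : (toB6 g R H).Site, T (blockPiece (g := toB6 g R H) bv z f)) := by rw [hTf]
    _ ≤ ∑ z : (toB6 g R H).Site, bl2 (g := toB6 g R H) bu y'' (T (blockPiece (g := toB6 g R H) bv z f)) :=
        bl2_finset_sum_le' bu y'' _ _
    _ ≤ ∑ z : g.Site, (if Rel z y' then K' y'' y' * N else 0) := Finset.sum_le_sum fun z _ => hterm z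
    _ = ((Finset.univ.filter (fun z => Rel z y')).card : ℝ) * (K' y'' y' * N) := by
        rw [Finset.sum_ite, Finset.sum_const_zero, add_zero, Finset.sum_const, nsmul_eq_mul]
    _ ≤ (m : ℝ) * (K' y'' y' * N) := mul_le_mul_of_nonneg_right (by exact_mod_cast hmult y') hKN
    _ = m * K' y'' y' * N := by ring

omit [Fintype g.Site] [DecidableEq g.Site] in
/-- comparison of the (3.46) prefactors on a neighbourhood: 0 ≦ s ≦ CL·t with 1 ≦ CL, 0 ≦ t ⇒ pref6(s)_n ≦ CL²·pref6(t)_n for every n.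
[cite: Balaban1985BackgroundPropagators, (3.46) p.398 (the prefactors (Lʲη)², Lʲη, 1), bookkeeping] -/
theorem pref6_le_of_len_le {s t CL : ℝ} (hs : 0 ≤ s) (ht : 0 ≤ t) (hCL : 1 ≤ CL) (hst : s ≤ CL * t) (n : Fin 6) :
    B9.pref6 s n ≤ CL ^ 2 * B9.pref6 t n := by
  have hCL0 : 0 ≤ CL := zero_le_one.trans hCL
  have hCLt : 0 ≤ CL * t := mul_nonneg hCL0 ht
  have h1 : CL * t ≤ CL ^ 2 * t := by nlinarith
  have h2 : (1 : ℝ) ≤ CL ^ 2 * 1 := by nlinarith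
  fin_cases n
  · show s ^ 2 ≤ CL ^ 2 * t ^ 2
    calc s ^ 2 ≤ (CL * t) ^ 2 := pow_le_pow_left₀ hs hst 2
      _ = CL ^ 2 * t ^ 2 := by ring
  · show s ≤ CL ^ 2 * t; exact hst.trans h1
  · show s ≤ CL ^ 2 * t; exact hst.trans h1
  · show (1 : ℝ) ≤ CL ^ 2 * 1; exact h2
  · show (1 : ℝ) ≤ CL ^ 2 * 1; exact h2
  · show (1 : ℝ) ≤ CL ^ 2 * 1; exact h2

omit [Fintype g.Site] [DecidableEq g.Site] in
/-- comparison of the (3.43) prefactor on a neighbourhood: 0 ≦ s ≦ CL·t, 1 ≦ CL, 0 ≦ t, 0 ≦ β ≦ 1 ⇒ s^{1−β} ≦ CL·t^{1−β}.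
[cite: Balaban1985BackgroundPropagators, (3.43) p.398 (the prefactor (Lʲη)^{1−β}), bookkeeping] -/
theorem rpow_one_sub_le_of_len_le {s t CL β : ℝ} (hs : 0 ≤ s) (ht : 0 ≤ t) (hCL : 1 ≤ CL) (hst : s ≤ CL * t)
    (hβ0 : 0 ≤ β) (hβ1 : β ≤ 1) : s ^ (1 - β) ≤ CL * t ^ (1 - β) := by
  have hCL0 : 0 ≤ CL := zero_le_one.trans hCL
  have he : 0 ≤ 1 - β := by linarith
  calc s ^ (1 - β) ≤ (CL * t) ^ (1 - β) := Real.rpow_le_rpow hs hst he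
    _ = CL ^ (1 - β) * t ^ (1 - β) := Real.mul_rpow hCL0 ht
    _ ≤ CL ^ (1 : ℝ) * t ^ (1 - β) :=
        mul_le_mul_of_nonneg_right (Real.rpow_le_rpow_of_exponent_le hCL (by linarith)) (Real.rpow_nonneg ht _)
    _ = CL * t ^ (1 - β) := by rw [Real.rpow_one]

omit [Fintype g.Site] [DecidableEq g.Site] in
/-- comparison of the (3.45) prefactor on a neighbourhood: 0 < t ≦ CL·s, 1 ≦ CL, 0 ≦ β ≦ 1 ⇒ s^{−β} ≦ CL·t^{−β}.
[cite: Balaban1985BackgroundPropagators, (3.45) p.398 (the prefactor (Lʲη)^{−β}), bookkeeping] -/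
theorem rpow_neg_le_of_len_le {s t CL β : ℝ} (ht : 0 < t) (hCL : 1 ≤ CL) (hts : t ≤ CL * s)
    (hβ0 : 0 ≤ β) (hβ1 : β ≤ 1) : s ^ (-β) ≤ CL * t ^ (-β) := by
  have hCL0 : 0 < CL := zero_lt_one.trans_le hCL
  have hq : 0 < t / CL := div_pos ht hCL0
  have hqs : t / CL ≤ s := by rw [div_le_iff₀ hCL0]; linarith [mul_comm CL s]
  calc s ^ (-β) ≤ (t / CL) ^ (-β) := Real.rpow_le_rpow_of_nonpos hq hqs (by linarith)
    _ = t ^ (-β) * CL ^ β := by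
        rw [Real.div_rpow ht.le hCL0.le, Real.rpow_neg hCL0.le, div_inv_eq_mul]
    _ ≤ t ^ (-β) * CL ^ (1 : ℝ) :=
        mul_le_mul_of_nonneg_left (Real.rpow_le_rpow_of_exponent_le hCL hβ1) (Real.rpow_nonneg ht.le _)
    _ = CL * t ^ (-β) := by rw [Real.rpow_one, mul_comm]

omit [Fintype g.Site] [DecidableEq g.Site] in
/-- the exponential weight on a neighbourhood: d(y″, y) ≦ r, d symmetric with the triangle inequality, 0 ≦ δ ⇒ e^{−δd(y″,b)} ≦ e^{rδ}·e^{−δd(y,b)}.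
[cite: Balaban1985BackgroundPropagators, (3.42)–(3.46) p.398 (the factor e^{−δ₀d(y,y′)}), bookkeeping] -/
theorem exp_shift_of_dist_le {δ r : ℝ} (hδ : 0 ≤ δ) (htri : ∀ a b c : g.Site, g.dist a c ≤ g.dist a b + g.dist b c)
    (hdsymm : ∀ a b : g.Site, g.dist a b = g.dist b a) {y y'' : g.Site} (hy : g.dist y'' y ≤ r) (b : g.Site) :
    Real.exp (-(δ * g.dist y'' b)) ≤ Real.exp (r * δ) * Real.exp (-(δ * g.dist y b)) := by
  rw [← Real.exp_add, Real.exp_le_exp]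
  have h1 : g.dist y b ≤ g.dist y y'' + g.dist y'' b := htri y y'' b
  rw [hdsymm y y''] at h1
  nlinarith

end Cores

/-! ## §2 The three co-reading schemas with the observation on the metric neighbourhood -/

section Schemas

variable {g : B9.Geometry} [Fintype g.Site] {R : ℝ} {H : Prop} {B : B9.Backgrounds}

/-- ★ **CO-READING OF THE n-TH L² QUANTITY (3.46) OF A KERNEL FAMILY BY A MODEL OPERATOR — SUPPORT SIDE RELATIVE TO A BLOCK EQUIVALENCE
`Rel`, OBSERVATION ON THE NEIGHBOURHOOD OF RADIUS r** (the second repair of `B9RWSums346Schur.L2Reads`; cf. `B9RWSumsReadsRel.L2ReadsRel`).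
Print, (3.46) p. 398: the bounded quantity is ‖h·(Tλ)‖ with supp h ⊂ Δ(y) (the record reads Δ̃(y)), against |h|·‖λ‖, supp λ ⊂ Δ(y′).
Typed: `off` — supp λ ⊂ Δ(y′) ⇒ `ev λ` vanishes at the model points x′ with `¬ Rel (bv x′) y′`; `l2bound` — every fibre-L² size of `ev λ`
over the class of y′ is ≦ Cev·‖λ‖ (the constant of the evaluation: √((d+1)|κ|) for a κ-fold diagonal evaluation); `obs` — `K.l2 n U λ h` is
BELOW every c ≧ 0 with (Σ over the sites y″ with d(y″, y) ≦ r of the fibre-L² sizes of T(ev λ))·|h| ≦ c whenever `cutIn h y`.  OURS (typing):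
a hypothesis schema on how a model instantiates `l2Norm` ∕ `cutSup` ∕ `KernelFamily.l2`; nothing is asserted.
[cite: Balaban1985BackgroundPropagators, (3.46) p.398 + p.397 (Δ̃)] -/
structure L2ReadsNbr {u v : Type} [Fintype u] [Fintype v] (K : B9.KernelFamily g B) (n : Fin 6) (U : B.Cfg)
    (Rel : g.Site → g.Site → Prop) (r Cev : ℝ) (bu : u → g.Site) (bv : v → g.Site) (ev : g.Loc → v → ℝ)
    (T : (v → ℝ) →ₗ[ℝ] (u → ℝ)) : Prop where
  off : ∀ (lam : g.Loc) (y' : g.Site), g.suppIn lam y' → ∀ x', ¬ Rel (bv x') y' → ev lam x' = 0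
  l2bound : ∀ (lam : g.Loc) (y' y'' : g.Site), g.suppIn lam y' → Rel y'' y' →
    bl2 (g := toB6 g R H) bv y'' (ev lam) ≤ Cev * g.l2Norm lam
  l2norm_nonneg : ∀ lam : g.Loc, 0 ≤ g.l2Norm lam
  cutSup_nonneg : ∀ h : g.Cut, 0 ≤ g.cutSup h
  obs : ∀ (lam : g.Loc) (h : g.Cut) (y : g.Site) (c : ℝ), 0 ≤ c → g.cutIn h y →
    (∑ y'' ∈ nbr g r y, bl2 (g := toB6 g R H) bu y'' (T (ev lam))) * g.cutSup h ≤ c → K.l2 n U lam h ≤ c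

variable {X Y PX PY : Type}

/-- ★ **CO-READING OF THE HÖLDER QUANTITY `K.h1` ((3.43)) BY TWO MODEL OPERATORS THROUGH THE PROBES — SUPPORT SIDE RELATIVE TO `Rel`,
PROBES ANCHORED WITHIN DISTANCE r OF y** (the second repair of `B9RWSums343Holder.H1Reads`).  Print, (3.43) p. 398 + (3.40) p. 397, *"ζ ∈
C₀^∞(Δ̃(y))"*.  Typed: `off`∕`offY` — supp λ ⊂ Δ(y′) ⇒ the evaluations on X and Y vanish at the model points whose site is not in the
class of y′; `bound`∕`boundY` — |ev λ|, |evY λ| ≦ |λ|; `obs` — for `cutInT ζ y`: h1(U, λ, β, ζ) ≦ c·(‖ζ‖^ξ_β + |ζ|) whenever every probe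
anchored at a site within distance r of y is ≦ c on T_L(ev λ) and on T_R(evY λ).  A HYPOTHESIS SCHEMA; nothing asserted.
[cite: Balaban1985BackgroundPropagators, (3.43) p.398 + (3.40) p.397] -/
structure H1ReadsNbr (K : B9.KernelFamily g B) (U : B.Cfg) (𝔭 : HolderProbes g B X Y PX PY)
    (Rel : g.Site → g.Site → Prop) (r : ℝ) (blk : X → g.Site) (blkY : Y → g.Site) (ev : g.Loc → X → ℝ)
    (evY : g.Loc → Y → ℝ) (TL : (X → ℝ) →ₗ[ℝ] (Y → ℝ)) (TR : (Y → ℝ) →ₗ[ℝ] (X → ℝ)) : Prop where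
  off : ∀ (lam : g.Loc) (y' : g.Site), g.suppIn lam y' → ∀ x, ¬ Rel (blk x) y' → ev lam x = 0
  bound : ∀ (lam : g.Loc) (x : X), |ev lam x| ≤ g.supNorm lam
  offY : ∀ (lam : g.Loc) (y' : g.Site), g.suppIn lam y' → ∀ v, ¬ Rel (blkY v) y' → evY lam v = 0
  boundY : ∀ (lam : g.Loc) (v : Y), |evY lam v| ≤ g.supNorm lam
  norm_nonneg : ∀ lam : g.Loc, 0 ≤ g.supNorm lam
  cutH_nonneg : ∀ (β : ℝ) (ζ : g.Cut), 0 ≤ g.cutH β ζ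
  obs : ∀ (lam : g.Loc) (β : ℝ) (ζ : g.Cut) (y : g.Site) (c : ℝ), 0 ≤ c → g.cutInT ζ y →
    (∀ p : PY, g.dist (𝔭.blkPY p) y ≤ r → |𝔭.ΦY U β (TL (ev lam)) p| ≤ c) →
    (∀ p : PX, g.dist (𝔭.blkPX p) y ≤ r → |𝔭.ΦX U β (TR (evY lam)) p| ≤ c) →
    K.h1 U lam β ζ ≤ c * g.cutH β ζ

/-- ★ **CO-READING OF THE INPUT-HÖLDER QUANTITIES `K.e4` ((3.44)) AND `K.h2` ((3.45)) BY THE MODEL OPERATOR A — OBSERVATION WITHIN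
DISTANCE r OF y** (the second repair of `B9RWSums344Input.InputReads`).  The input side is read through the block-norm LETTER `bH ε` (its
own localisation `IsLoc`, unchanged); `obs4` — e4(U, λ, y) ≦ c whenever |A(evY λ)| ≦ c at every model point whose site is within distance r
of y; `obs5` — for `cutInT ζ y`: h2(U, λ, β, ζ) ≦ c·(‖ζ‖^ξ_β + |ζ|) whenever every probe anchored within distance r of y is ≦ c on A(evY λ).
A HYPOTHESIS SCHEMA; nothing asserted. [cite: Balaban1985BackgroundPropagators, (3.44)–(3.45) p.398 + (3.40) p.397] -/
structure InputReadsNbr [Fintype Y] (K : B9.KernelFamily g B) (U : B.Cfg) (𝔭 : HolderProbes g B X Y PX PY)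
    (bH : ℝ → BlockNorm (toB6 g R H) (Y → ℝ)) (r : ℝ) (blkY : Y → g.Site)
    (evY : g.Loc → Y → ℝ) (A : (Y → ℝ) →ₗ[ℝ] (Y → ℝ)) : Prop where
  isLoc : ∀ (ε : ℝ) (lam : g.Loc) (y' : g.Site), g.suppInT lam y' → (bH ε).IsLoc y' (evY lam)
  loc_le : ∀ (ε : ℝ) (lam : g.Loc) (y' : g.Site), g.suppInT lam y' →
    (bH ε).loc y' (evY lam) ≤ g.holder ε lam + g.supNorm lam
  hs_nonneg : ∀ (ε : ℝ) (lam : g.Loc), 0 ≤ g.holder ε lam + g.supNorm lam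
  cutH_nonneg : ∀ (β : ℝ) (ζ : g.Cut), 0 ≤ g.cutH β ζ
  obs4 : ∀ (lam : g.Loc) (y : g.Site) (c : ℝ), 0 ≤ c → (∀ v : Y, g.dist (blkY v) y ≤ r → |A (evY lam) v| ≤ c) →
    K.e4 U lam y ≤ c
  obs5 : ∀ (lam : g.Loc) (β : ℝ) (ζ : g.Cut) (y : g.Site) (c : ℝ), 0 ≤ c → g.cutInT ζ y →
    (∀ p : PY, g.dist (𝔭.blkPY p) y ≤ r → |𝔭.ΦY U β (A (evY lam)) p| ≤ c) → K.h2 U lam β ζ ≤ c * g.cutH β ζ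

end Schemas

/-! ## §3 The engines: the member lines AS TYPED, the neighbourhood count and the level comparability in the constant -/

section Engines

variable {g : B9.Geometry} [Fintype g.Site] [DecidableEq g.Site] {R : ℝ} {H : Prop} {B : B9.Backgrounds}

/-- ★ **AN L² BLOCK BOUND OF THE PRINTED SHAPE ⇒ THE n-TH (3.46) LINE AS TYPED, NEIGHBOURHOOD READING.**  If T has the block bound
B′·pref6(Lʲη)_n·e^{−δ′d(y,y′)} between the fibres of `bv` (input) and `bu` (output), B′ ≧ 0, 0 ≦ δ′, `K.l2 n` is co-read by T (support side
relative to `Rel`, class count ≦ m, d saturated on classes in its second argument; observation radius r ≧ 0 with neighbourhood count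
≦ mN, level comparability CL on distance ≦ r, d a symmetric semi-metric), then ∀ λ h y y′ (`cutIn h y`, supp λ ⊂ Δ(y′)):
K.l2 n U λ h ≦ (mN·m·Cev·CL²·e^{rδ′}·B′)·pref6(Lʲη)_n·|h|·e^{−δ′d(y,y′)}·‖λ‖.
[cite: Balaban1985BackgroundPropagators, (3.46) p.398; Balaban1984PropagatorsII, (2.51)–(2.52) p.232] -/
theorem l2line_of_blockBd_nbr {u v : Type} [Fintype u] [Fintype v] {K : B9.KernelFamily g B} {n : Fin 6} {U : B.Cfg}
    {Rel : g.Site → g.Site → Prop} [DecidableRel Rel] {r Cev : ℝ} {bu : u → g.Site} {bv : v → g.Site} {ev : g.Loc → v → ℝ}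
    {T : (v → ℝ) →ₗ[ℝ] (u → ℝ)} (hR : L2ReadsNbr (R := R) (H := H) K n U Rel r Cev bu bv ev T)
    (hRd₂ : ∀ a b b', Rel b b' → g.dist a b = g.dist a b')
    {m : ℕ} (hmult : ∀ y' : g.Site, (Finset.univ.filter (fun y'' => Rel y'' y')).card ≤ m)
    {mN : ℕ} (hnbr : ∀ y : g.Site, (nbr g r y).card ≤ mN)
    {CL : ℝ} (hCL1 : 1 ≤ CL) (hCL : ∀ a a' : g.Site, g.dist a a' ≤ r → g.len a ≤ CL * g.len a')
    (htri : ∀ a b c : g.Site, g.dist a c ≤ g.dist a b + g.dist b c) (hdsymm : ∀ a b : g.Site, g.dist a b = g.dist b a)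
    {B' δ' : ℝ} (hB : 0 ≤ B') (hδ' : 0 ≤ δ') (hCev : 0 ≤ Cev) (hlen : ∀ y : g.Site, 0 ≤ g.len y)
    (hT : BlockBd (g := toB6 g R H) bv bu T
      (fun (y y' : g.Site) => B' * B9.pref6 (g.len y) n * Real.exp (-(δ' * g.dist y y')))) :
    ∀ (lam : g.Loc) (h : g.Cut) (y y' : g.Site), g.cutIn h y → g.suppIn lam y' →
      K.l2 n U lam h ≤ (mN * m * Cev * CL ^ 2 * Real.exp (r * δ') * B') * B9.pref6 (g.len y) n * g.cutSup h *
        Real.exp (-(δ' * g.dist y y')) * g.l2Norm lam := by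
  intro lam h y y' hcut hsupp
  have hK' : ∀ a b : g.Site, 0 ≤ B' * B9.pref6 (g.len a) n * Real.exp (-(δ' * g.dist a b)) := fun a b =>
    mul_nonneg (mul_nonneg hB (B9FromB6.pref6_nonneg (hlen a) n)) (Real.exp_nonneg _)
  have hsat₂ : ∀ a b b' : g.Site, Rel b b' →
      B' * B9.pref6 (g.len a) n * Real.exp (-(δ' * g.dist a b)) = B' * B9.pref6 (g.len a) n * Real.exp (-(δ' * g.dist a b')) :=
    fun a b b' hr => by rw [hRd₂ a b b' hr]
  have hN : 0 ≤ Cev * g.l2Norm lam := mul_nonneg hCev (hR.l2norm_nonneg lam)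
  -- every target fibre
  have hfib : ∀ y'' : g.Site, bl2 (g := toB6 g R H) bu y'' (T (ev lam)) ≤
      m * (B' * B9.pref6 (g.len y'') n * Real.exp (-(δ' * g.dist y'' y'))) * (Cev * g.l2Norm lam) := fun y'' =>
    bl2_le_of_blockBd_supp (R := R) (H := H) hK' hsat₂ hmult hT hN
      (fun z hz => hR.l2bound lam y' z hsupp hz) (hR.off lam y' hsupp) y''
  -- the fibres of the neighbourhood, compared with y
  set W : ℝ := m * (B' * (CL ^ 2 * B9.pref6 (g.len y) n) * (Real.exp (r * δ') * Real.exp (-(δ' * g.dist y y')))) *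
    (Cev * g.l2Norm lam) with hW
  have hW0 : 0 ≤ W := by
    rw [hW]
    exact mul_nonneg (mul_nonneg (Nat.cast_nonneg m) (mul_nonneg (mul_nonneg hB (mul_nonneg (sq_nonneg _)
      (B9FromB6.pref6_nonneg (hlen y) n))) (mul_nonneg (Real.exp_nonneg _) (Real.exp_nonneg _)))) hN
  have hnb : ∀ y'' ∈ nbr g r y, bl2 (g := toB6 g R H) bu y'' (T (ev lam)) ≤ W := by
    intro y'' hy''
    have hd : g.dist y'' y ≤ r := mem_nbr.1 hy''
    have h1 : B9.pref6 (g.len y'') n ≤ CL ^ 2 * B9.pref6 (g.len y) n :=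
      pref6_le_of_len_le (hlen y'') (hlen y) hCL1 (hCL y'' y hd) n
    have h2 : Real.exp (-(δ' * g.dist y'' y')) ≤ Real.exp (r * δ') * Real.exp (-(δ' * g.dist y y')) :=
      exp_shift_of_dist_le hδ' htri hdsymm hd y'
    refine (hfib y'').trans ?_
    rw [hW]
    refine mul_le_mul_of_nonneg_right (mul_le_mul_of_nonneg_left ?_ (Nat.cast_nonneg m)) hN
    exact mul_le_mul (mul_le_mul_of_nonneg_left h1 hB) h2 (Real.exp_nonneg _)
      (mul_nonneg hB (mul_nonneg (sq_nonneg _) (B9FromB6.pref6_nonneg (hlen y) n)))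
  have hsum : ∑ y'' ∈ nbr g r y, bl2 (g := toB6 g R H) bu y'' (T (ev lam)) ≤ mN * W :=
    calc ∑ y'' ∈ nbr g r y, bl2 (g := toB6 g R H) bu y'' (T (ev lam)) ≤ ∑ y'' ∈ nbr g r y, W :=
          Finset.sum_le_sum hnb
      _ = ((nbr g r y).card : ℝ) * W := by rw [Finset.sum_const, nsmul_eq_mul]
      _ ≤ (mN : ℝ) * W := mul_le_mul_of_nonneg_right (by exact_mod_cast hnbr y) hW0
  have hc : 0 ≤ (mN * m * Cev * CL ^ 2 * Real.exp (r * δ') * B') * B9.pref6 (g.len y) n * g.cutSup h *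
      Real.exp (-(δ' * g.dist y y')) * g.l2Norm lam :=
    mul_nonneg (mul_nonneg (mul_nonneg (mul_nonneg (mul_nonneg (mul_nonneg (mul_nonneg (mul_nonneg (mul_nonneg
      (Nat.cast_nonneg mN) (Nat.cast_nonneg m)) hCev) (sq_nonneg _)) (Real.exp_nonneg _)) hB)
      (B9FromB6.pref6_nonneg (hlen y) n)) (hR.cutSup_nonneg h)) (Real.exp_nonneg _)) (hR.l2norm_nonneg lam)
  refine hR.obs lam h y _ hc hcut ?_
  calc (∑ y'' ∈ nbr g r y, bl2 (g := toB6 g R H) bu y'' (T (ev lam))) * g.cutSup h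
      ≤ (mN * W) * g.cutSup h := mul_le_mul_of_nonneg_right hsum (hR.cutSup_nonneg h)
    _ = (mN * m * Cev * CL ^ 2 * Real.exp (r * δ') * B') * B9.pref6 (g.len y) n * g.cutSup h *
        Real.exp (-(δ' * g.dist y y')) * g.l2Norm lam := by rw [hW]; ring

variable {X Y PX PY : Type}

/-- ★ **TWO PROBE MAJORANTS OF THE PRINTED SHAPE ⇒ THE (3.43) LINE AS TYPED, NEIGHBOURHOOD READING.**  If for every 0 ≦ β < 1 the model
operators read through the probes, Φ^Y_β(U)∘T_L and Φ^X_β(U)∘T_R, have the two-space sup majorants B(β)(Lʲη)^{1−β}e^{−δ₀d(y,y′)} with B(β) ≧ 0,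
0 ≦ δ₀, `K.h1` is co-read by (T_L, T_R) through the probes (support side relative to `Rel`, class count ≦ m, d saturated on classes in its
second argument; probes within distance r ≧ 0 of y, level comparability CL, d a symmetric semi-metric), then ∀ β λ ζ y y′ (0 ≦ β < 1,
`cutInT ζ y`, supp λ ⊂ Δ(y′)): h1(U, λ, β, ζ) ≦ (m·CL·e^{rδ₀}·B(β))(Lʲη)^{1−β}(‖ζ‖^ξ_β + |ζ|)e^{−δ₀d(y,y′)}|λ|.
[cite: Balaban1985BackgroundPropagators, (3.43) p.398; Balaban1984PropagatorsII, (2.51)–(2.52) p.232] -/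
theorem line343_of_hasMajorantHom_nbr {K : B9.KernelFamily g B} {U : B.Cfg} {𝔭 : HolderProbes g B X Y PX PY}
    {Rel : g.Site → g.Site → Prop} [DecidableRel Rel] {r : ℝ} {blk : X → g.Site} {blkY : Y → g.Site} {ev : g.Loc → X → ℝ}
    {evY : g.Loc → Y → ℝ} {TL : (X → ℝ) →ₗ[ℝ] (Y → ℝ)} {TR : (Y → ℝ) →ₗ[ℝ] (X → ℝ)}
    (hR : H1ReadsNbr K U 𝔭 Rel r blk blkY ev evY TL TR)
    (hRd₂ : ∀ a b b', Rel b b' → g.dist a b = g.dist a b')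
    {m : ℕ} (hmult : ∀ y' : g.Site, (Finset.univ.filter (fun y'' => Rel y'' y')).card ≤ m)
    {CL : ℝ} (hCL1 : 1 ≤ CL) (hCL : ∀ a a' : g.Site, g.dist a a' ≤ r → g.len a ≤ CL * g.len a')
    (htri : ∀ a b c : g.Site, g.dist a c ≤ g.dist a b + g.dist b c) (hdsymm : ∀ a b : g.Site, g.dist a b = g.dist b a)
    {Bβ : ℝ → ℝ} {δ₀ : ℝ} (hB : ∀ β, 0 ≤ β → β < 1 → 0 ≤ Bβ β) (hδ₀ : 0 ≤ δ₀) (hlen : ∀ y : g.Site, 0 ≤ g.len y)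
    (hL : ∀ β, 0 ≤ β → β < 1 → HasMajorantHom (g := toB6 g R H) blk 𝔭.blkPY (𝔭.ΦY U β ∘ₗ TL)
      (fun (a b : g.Site) => Bβ β * g.len a ^ (1 - β) * Real.exp (-(δ₀ * g.dist a b))))
    (hRt : ∀ β, 0 ≤ β → β < 1 → HasMajorantHom (g := toB6 g R H) blkY 𝔭.blkPX (𝔭.ΦX U β ∘ₗ TR)
      (fun (a b : g.Site) => Bβ β * g.len a ^ (1 - β) * Real.exp (-(δ₀ * g.dist a b)))) :
    ∀ (β : ℝ) (lam : g.Loc) (ζ : g.Cut) (y y' : g.Site), 0 ≤ β → β < 1 → g.cutInT ζ y → g.suppIn lam y' →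
      K.h1 U lam β ζ ≤ (m * CL * Real.exp (r * δ₀) * Bβ β) * (g.len y) ^ (1 - β) * g.cutH β ζ *
        Real.exp (-(δ₀ * g.dist y y')) * g.supNorm lam := by
  intro β lam ζ y y' hβ0 hβ1 hζ hs
  have hK' : ∀ a b : g.Site, 0 ≤ Bβ β * g.len a ^ (1 - β) * Real.exp (-(δ₀ * g.dist a b)) := fun a b =>
    mul_nonneg (mul_nonneg (hB β hβ0 hβ1) (Real.rpow_nonneg (hlen a) _)) (Real.exp_nonneg _)
  have hsat₂ : ∀ a b b' : g.Site, Rel b b' →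
      Bβ β * g.len a ^ (1 - β) * Real.exp (-(δ₀ * g.dist a b)) = Bβ β * g.len a ^ (1 - β) * Real.exp (-(δ₀ * g.dist a b')) :=
    fun a b b' hr => by rw [hRd₂ a b b' hr]
  have hN := hR.norm_nonneg lam
  -- the comparison of the majorant at a site within distance r of y with the majorant at y
  have hcmp : ∀ a : g.Site, g.dist a y ≤ r →
      (m : ℝ) * (Bβ β * g.len a ^ (1 - β) * Real.exp (-(δ₀ * g.dist a y'))) * g.supNorm lam ≤
        (m * CL * Real.exp (r * δ₀) * Bβ β) * g.len y ^ (1 - β) * Real.exp (-(δ₀ * g.dist y y')) * g.supNorm lam := by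
    intro a ha
    have h1 : g.len a ^ (1 - β) ≤ CL * g.len y ^ (1 - β) :=
      rpow_one_sub_le_of_len_le (hlen a) (hlen y) hCL1 (hCL a y ha) hβ0 hβ1.le
    have h2 : Real.exp (-(δ₀ * g.dist a y')) ≤ Real.exp (r * δ₀) * Real.exp (-(δ₀ * g.dist y y')) :=
      exp_shift_of_dist_le hδ₀ htri hdsymm ha y'
    have h12 : g.len a ^ (1 - β) * Real.exp (-(δ₀ * g.dist a y')) ≤
        (CL * g.len y ^ (1 - β)) * (Real.exp (r * δ₀) * Real.exp (-(δ₀ * g.dist y y'))) :=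
      mul_le_mul h1 h2 (Real.exp_nonneg _) (mul_nonneg (zero_le_one.trans hCL1) (Real.rpow_nonneg (hlen y) _))
    have h3 := mul_le_mul_of_nonneg_left h12 (hB β hβ0 hβ1)
    have h4 := mul_le_mul_of_nonneg_right (mul_le_mul_of_nonneg_left h3 (Nat.cast_nonneg m)) hN
    calc (m : ℝ) * (Bβ β * g.len a ^ (1 - β) * Real.exp (-(δ₀ * g.dist a y'))) * g.supNorm lam
        = (m : ℝ) * (Bβ β * (g.len a ^ (1 - β) * Real.exp (-(δ₀ * g.dist a y')))) * g.supNorm lam := by ring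
      _ ≤ (m : ℝ) * (Bβ β * ((CL * g.len y ^ (1 - β)) * (Real.exp (r * δ₀) * Real.exp (-(δ₀ * g.dist y y'))))) *
          g.supNorm lam := h4
      _ = (m * CL * Real.exp (r * δ₀) * Bβ β) * g.len y ^ (1 - β) * Real.exp (-(δ₀ * g.dist y y')) * g.supNorm lam := by
          ring
  have hc : 0 ≤ (m * CL * Real.exp (r * δ₀) * Bβ β) * g.len y ^ (1 - β) * Real.exp (-(δ₀ * g.dist y y')) * g.supNorm lam :=
    mul_nonneg (mul_nonneg (mul_nonneg (mul_nonneg (mul_nonneg (mul_nonneg (Nat.cast_nonneg m) (zero_le_one.trans hCL1))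
      (Real.exp_nonneg _)) (hB β hβ0 hβ1)) (Real.rpow_nonneg (hlen y) _)) (Real.exp_nonneg _)) hN
  have hobs := hR.obs lam β ζ y _ hc hζ
    (fun p hp => (abs_le_of_hasMajorantHom_supp (R := R) (H := H) hK' hsat₂ hmult (hL β hβ0 hβ1) hN
      (hR.bound lam) (hR.off lam y' hs) p).trans (hcmp _ hp))
    (fun p hp => (abs_le_of_hasMajorantHom_supp (R := R) (H := H) hK' hsat₂ hmult (hRt β hβ0 hβ1) hN
      (hR.boundY lam) (hR.offY lam y' hs) p).trans (hcmp _ hp))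
  exact hobs.trans (le_of_eq (by ring))

omit [DecidableEq g.Site] in
/-- ★ **TWO BLOCK-NORM MAJORANTS OF THE PRINTED SHAPES ⇒ THE (3.44) AND (3.45) LINES AS TYPED, NEIGHBOURHOOD READING** (the input block
norm `bH ε` localises by its own letter; the model points ∕ probes within distance r of y carry the factor e^{rδ₀}, and (3.45)'s negative
power the level comparability CL): if for 0 < ε ≦ 1 the operator A read from `bH ε` into the sharp blocks of Y has the majorant
B′(ε)e^{−δ₀d(y,y′)}, and for 0 < ε ≦ 1, 0 ≦ β < 1 the operator Φ^Y_β∘A read from `bH (β+ε)` into the probe lattice has the majorant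
B′(ε,β)(Lʲη)^{−β}e^{−δ₀d(y,y′)}, then the (3.44) and (3.45) lines hold for K at U with constants e^{rδ₀}B′(ε), CL·e^{rδ₀}B′(ε,β).
[cite: Balaban1985BackgroundPropagators, (3.44)–(3.45) p.398] -/
theorem lines3445_of_hasMaj_nbr [Fintype Y] [Fintype PY] {K : B9.KernelFamily g B} {U : B.Cfg}
    {𝔭 : HolderProbes g B X Y PX PY} {bH : ℝ → BlockNorm (toB6 g R H) (Y → ℝ)} {r : ℝ}
    {blkY : Y → g.Site} {evY : g.Loc → Y → ℝ} {A : (Y → ℝ) →ₗ[ℝ] (Y → ℝ)} (hR : InputReadsNbr K U 𝔭 bH r blkY evY A)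
    {CL : ℝ} (hCL1 : 1 ≤ CL) (hCL : ∀ a a' : g.Site, g.dist a a' ≤ r → g.len a ≤ CL * g.len a')
    (htri : ∀ a b c : g.Site, g.dist a c ≤ g.dist a b + g.dist b c) (hdsymm : ∀ a b : g.Site, g.dist a b = g.dist b a)
    {Bε : ℝ → ℝ} {Bεβ : ℝ → ℝ → ℝ} {δ₀ : ℝ}
    (hBε : ∀ ε, 0 < ε → ε ≤ 1 → 0 ≤ Bε ε) (hBεβ : ∀ ε β, 0 < ε → ε ≤ 1 → 0 ≤ β → β < 1 → 0 ≤ Bεβ ε β)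
    (hδ₀ : 0 ≤ δ₀) (hlen : ∀ y : g.Site, 0 < g.len y)
    (h44 : ∀ ε, 0 < ε → ε ≤ 1 → HasMaj (bH ε) (BlockNorm.ofBlocks (toB6 g R H) blkY) A
      (fun (a b : g.Site) => Bε ε * Real.exp (-(δ₀ * g.dist a b))))
    (h45 : ∀ ε β, 0 < ε → ε ≤ 1 → 0 ≤ β → β < 1 →
      HasMaj (bH (β + ε)) (BlockNorm.ofBlocks (toB6 g R H) 𝔭.blkPY) (𝔭.ΦY U β ∘ₗ A)
        (fun (a b : g.Site) => Bεβ ε β * g.len a ^ (-β) * Real.exp (-(δ₀ * g.dist a b)))) :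
    (∀ (ε : ℝ) (lam : g.Loc) (y y' : g.Site), 0 < ε → ε ≤ 1 → g.suppInT lam y' →
        K.e4 U lam y ≤ (Real.exp (r * δ₀) * Bε ε) * Real.exp (-(δ₀ * g.dist y y')) * (g.holder ε lam + g.supNorm lam)) ∧
      (∀ (ε β : ℝ) (lam : g.Loc) (ζ : g.Cut) (y y' : g.Site), 0 < ε → ε ≤ 1 → 0 ≤ β → β < 1 →
        g.cutInT ζ y → g.suppInT lam y' →
        K.h2 U lam β ζ ≤ (CL * Real.exp (r * δ₀) * Bεβ ε β) * (g.len y) ^ (-β) * g.cutH β ζ *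
          Real.exp (-(δ₀ * g.dist y y')) * (g.holder (β + ε) lam + g.supNorm lam)) := by
  refine ⟨fun ε lam y y' hε0 hε1 hs => ?_, fun ε β lam ζ y y' hε0 hε1 hβ0 hβ1 hζ hs => ?_⟩
  · have hK : 0 ≤ (Real.exp (r * δ₀) * Bε ε) * Real.exp (-(δ₀ * g.dist y y')) :=
      mul_nonneg (mul_nonneg (Real.exp_nonneg _) (hBε ε hε0 hε1)) (Real.exp_nonneg _)
    have hc : 0 ≤ (Real.exp (r * δ₀) * Bε ε) * Real.exp (-(δ₀ * g.dist y y')) * (g.holder ε lam + g.supNorm lam) :=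
      mul_nonneg hK (hR.hs_nonneg ε lam)
    refine hR.obs4 lam y _ hc fun v hv => ?_
    have hb : (BlockNorm.ofBlocks (toB6 g R H) blkY).loc (blkY v) (A (evY lam)) ≤
        Bε ε * Real.exp (-(δ₀ * g.dist (blkY v) y')) * (bH ε).loc y' (evY lam) :=
      h44 ε hε0 hε1 y' (evY lam) (hR.isLoc ε lam y' hs) (blkY v)
    have hpt := abs_apply_le_ofBlocks_loc (G := toB6 g R H) blkY (blkY v) (A (evY lam)) v rfl
    have h2 : Real.exp (-(δ₀ * g.dist (blkY v) y')) ≤ Real.exp (r * δ₀) * Real.exp (-(δ₀ * g.dist y y')) :=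
      exp_shift_of_dist_le hδ₀ htri hdsymm hv y'
    have h3 : Bε ε * Real.exp (-(δ₀ * g.dist (blkY v) y')) ≤ (Real.exp (r * δ₀) * Bε ε) * Real.exp (-(δ₀ * g.dist y y')) := by
      calc Bε ε * Real.exp (-(δ₀ * g.dist (blkY v) y')) ≤ Bε ε * (Real.exp (r * δ₀) * Real.exp (-(δ₀ * g.dist y y'))) :=
            mul_le_mul_of_nonneg_left h2 (hBε ε hε0 hε1)
        _ = (Real.exp (r * δ₀) * Bε ε) * Real.exp (-(δ₀ * g.dist y y')) := by ring
    have hloc0 : 0 ≤ (bH ε).loc y' (evY lam) := (bH ε).loc_nonneg _ _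
    exact hpt.trans (hb.trans ((mul_le_mul_of_nonneg_right h3 hloc0).trans
      (mul_le_mul_of_nonneg_left (hR.loc_le ε lam y' hs) hK)))
  · have hK : 0 ≤ (CL * Real.exp (r * δ₀) * Bεβ ε β) * g.len y ^ (-β) * Real.exp (-(δ₀ * g.dist y y')) :=
      mul_nonneg (mul_nonneg (mul_nonneg (mul_nonneg (zero_le_one.trans hCL1) (Real.exp_nonneg _))
        (hBεβ ε β hε0 hε1 hβ0 hβ1)) (Real.rpow_nonneg (hlen y).le _)) (Real.exp_nonneg _)
    have hc : 0 ≤ (CL * Real.exp (r * δ₀) * Bεβ ε β) * g.len y ^ (-β) * Real.exp (-(δ₀ * g.dist y y')) *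
        (g.holder (β + ε) lam + g.supNorm lam) := mul_nonneg hK (hR.hs_nonneg (β + ε) lam)
    have hobs := hR.obs5 lam β ζ y _ hc hζ fun p hp => by
      have hb : (BlockNorm.ofBlocks (toB6 g R H) 𝔭.blkPY).loc (𝔭.blkPY p) ((𝔭.ΦY U β ∘ₗ A) (evY lam)) ≤
          Bεβ ε β * g.len (𝔭.blkPY p) ^ (-β) * Real.exp (-(δ₀ * g.dist (𝔭.blkPY p) y')) *
            (bH (β + ε)).loc y' (evY lam) :=
        h45 ε β hε0 hε1 hβ0 hβ1 y' (evY lam) (hR.isLoc (β + ε) lam y' hs) (𝔭.blkPY p)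
      have hpt := abs_apply_le_ofBlocks_loc (G := toB6 g R H) 𝔭.blkPY (𝔭.blkPY p) ((𝔭.ΦY U β ∘ₗ A) (evY lam)) p rfl
      rw [LinearMap.comp_apply] at hpt
      have hpy : g.dist y (𝔭.blkPY p) ≤ r := by rw [hdsymm]; exact hp
      have h1 : g.len (𝔭.blkPY p) ^ (-β) ≤ CL * g.len y ^ (-β) :=
        rpow_neg_le_of_len_le (hlen y) hCL1 (hCL y (𝔭.blkPY p) hpy) hβ0 hβ1.le
      have h2 : Real.exp (-(δ₀ * g.dist (𝔭.blkPY p) y')) ≤ Real.exp (r * δ₀) * Real.exp (-(δ₀ * g.dist y y')) :=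
        exp_shift_of_dist_le hδ₀ htri hdsymm hp y'
      have h3 : Bεβ ε β * g.len (𝔭.blkPY p) ^ (-β) * Real.exp (-(δ₀ * g.dist (𝔭.blkPY p) y')) ≤
          (CL * Real.exp (r * δ₀) * Bεβ ε β) * g.len y ^ (-β) * Real.exp (-(δ₀ * g.dist y y')) := by
        have h12 : g.len (𝔭.blkPY p) ^ (-β) * Real.exp (-(δ₀ * g.dist (𝔭.blkPY p) y')) ≤
            (CL * g.len y ^ (-β)) * (Real.exp (r * δ₀) * Real.exp (-(δ₀ * g.dist y y'))) :=
          mul_le_mul h1 h2 (Real.exp_nonneg _) (mul_nonneg (zero_le_one.trans hCL1) (Real.rpow_nonneg (hlen y).le _))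
        calc Bεβ ε β * g.len (𝔭.blkPY p) ^ (-β) * Real.exp (-(δ₀ * g.dist (𝔭.blkPY p) y'))
            = Bεβ ε β * (g.len (𝔭.blkPY p) ^ (-β) * Real.exp (-(δ₀ * g.dist (𝔭.blkPY p) y'))) := by ring
          _ ≤ Bεβ ε β * ((CL * g.len y ^ (-β)) * (Real.exp (r * δ₀) * Real.exp (-(δ₀ * g.dist y y')))) :=
              mul_le_mul_of_nonneg_left h12 (hBεβ ε β hε0 hε1 hβ0 hβ1)
          _ = (CL * Real.exp (r * δ₀) * Bεβ ε β) * g.len y ^ (-β) * Real.exp (-(δ₀ * g.dist y y')) := by ring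
      have hloc0 : 0 ≤ (bH (β + ε)).loc y' (evY lam) := (bH (β + ε)).loc_nonneg _ _
      exact hpt.trans (hb.trans ((mul_le_mul_of_nonneg_right h3 hloc0).trans
        (mul_le_mul_of_nonneg_left (hR.loc_le (β + ε) lam y' hs) hK)))
    exact hobs.trans (le_of_eq (by ring))

end Engines

end Literature.MathematicalPhysics.QuantumFieldTheory.Balaban1983to89.B9RWSumsReadsNbr

end
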